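import Summits.CriticalPhenomena.PercolationContinuityZ3.Theorems.SoloInformedSheetCalculus
import HarnessLib

/-!
# The sheet calculus with a FRACTIONAL Bollobás–Riordan step
(solo seat `solo-CriticalPhenomena-informed`, paper §7b.3 (d9.3))

`SoloInformedSheetCalculus` records what curtain gluing (`glue`, kernel `real_sheet_gluing_sq`) and a
HYPOTHETICAL sheet version `br` of [BollobasRiordan2006, Lemma 6 + Cor. 7] derive.  The `d = 3`
proof of `br` dies at the one-point dichotomy: the seam along which the transversal sheet first meets
the virtually doubled anchor is a CURVE across the passive direction `x₂ ∈ [0, b]`, and lattice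
symmetry does not decide on which copy (real / mirror) a curve lies (paper (d6)(iii), (d7.1)).

This file asks how much of the passive width the step really has to secure.  The rule `brFrac`
(parameter `j ≥ 1`) has the premises of `br` — anchor `(h, b, t₀)`, transversal sheet `(m, b, 2h)`,
real sheet `Ξ = (t₀, b, h)`, `t₀ ≤ m` — but outputs only `(2m - t₀, b', 2h)` for the passive widths
`b'` with `j · b' ≤ b`: the reflection step is asked to produce the glued sheet over SOME passive
sub-interval of length `b / j` (the seam real there), not over all of `[0, b]`.  As an inequality
between blocking probabilities `brFrac j` is implied by `br` (a box of smaller passive width is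
easier to block) and gets weaker as `j` grows.

Results (induction on derivations; arithmetic by `omega`; derivations are data).

* `SheetCalcF.tame` — tame seeds still give only tame shapes (the cube seed reaches neither an
  `ε`-long square beam nor the near-cube brick: `cubeSeed_misses_nearCube_frac`).
* `nearCube_of_looseSeed_frac` — sharpness, uniformly in `j`: from type-`≤ 1` seeds ONE application
  of `brFrac j` with the square-beam anchor `(2, 6j, 2)` (length `3j`), transversal `(4, 6j, 4)` and
  `Ξ = (2, 6j, 2)` yields the `r = 4`, `u = 1` near-cube brick `(6, 6, 4)` of the cube face `(Q)`.
* `squareBeam_of_seedBeam_all` — the long anchors cost nothing new: gluing alone derives the square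
  beam `(k, 2, 2)` of EVERY length `k` from the `ε`-long beam `(3, 2, 2)` and the cube `(2, 2, 2)`
  (lengths `2ⁿ + 2` by iterating `real_sheet_gluing_sq`'s shape rule with a cube curtain, then `mono`).

Reading (paper (d9.3)).  Through the box faces, the Bollobás–Riordan input of (d7.2) may be weakened
to: for some fixed `j`, the reflection step secures a `1/j` FRACTION of the passive width (with
anchors of length `3j`, which gluing supplies from the seed beam).  The probabilistic content does not
get easier — "the seam is real over a passive window of fixed length" is violated by the staircase
soups of (d8.3) exactly like the full step — but the combinatorial requirement on a `d = 3`
Bollobás–Riordan lemma is now the weakest one this calculus can state.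

References.  [BollobasRiordan2006] B. Bollobás, O. Riordan, *A short proof of the Harris–Kesten
theorem*, Bull. LMS 38 (2006), arXiv:math/0410359, Lemma 6, Cor. 7.
-/

namespace Summit.CriticalPhenomena.PercolationContinuityZ3.Theorems

/-- Derivations from `Seed` by monotonicity, the lateral isometry, curtain gluing and the FRACTIONAL
Bollobás–Riordan rule with parameter `j`: the output keeps only a passive width `b'` with
`j * b' ≤ b`.  Data (`Type`-valued derivation trees). -/
inductive SheetCalcF (Seed : ℕ → ℕ → ℕ → Bool) (j : ℕ) : ℕ → ℕ → ℕ → Type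
  | seed {a b t : ℕ} : Seed a b t = true → SheetCalcF Seed j a b t
  | mono {a b t a' b' t' : ℕ} : SheetCalcF Seed j a b t → a' ≤ a → b' ≤ b → t ≤ t' →
      SheetCalcF Seed j a' b' t'
  | swap {a b t : ℕ} : SheetCalcF Seed j a b t → SheetCalcF Seed j b a t
  | glue {ℓ b t w : ℕ} : SheetCalcF Seed j ℓ b t → SheetCalcF Seed j t b w → w ≤ ℓ →
      SheetCalcF Seed j (2 * ℓ - w) b t
  | brFrac {t₀ h b m b' : ℕ} : SheetCalcF Seed j h b t₀ → SheetCalcF Seed j m b (2 * h) →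
      SheetCalcF Seed j t₀ b h → t₀ ≤ m → j * b' ≤ b → SheetCalcF Seed j (2 * m - t₀) b' (2 * h)

namespace SheetCalcF

variable {Seed : ℕ → ℕ → ℕ → Bool} {j : ℕ}

/-- **Tame seeds give tame shapes**, for every fraction parameter `j ≥ 1`: the fractional rule only
ever shrinks the passive width of the `br` output, and `TameShape` is closed under that. -/
theorem tame (hj : 1 ≤ j) (hS : ∀ a b t, Seed a b t = true → tameShape a b t = true) {a b t : ℕ}
    (h : SheetCalcF Seed j a b t) : tameShape a b t = true := by
  induction h with
  | seed hs => exact hS _ _ _ hs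
  | mono _ ha hb ht ih => rw [tameShape_iff] at *; omega
  | swap _ ih => rw [tameShape_iff] at *; omega
  | glue _ _ hw ih₁ ih₂ => rw [tameShape_iff] at *; omega
  | brFrac _ _ _ hm hb ih₁ ih₂ ih₃ =>
      rw [tameShape_iff] at *
      have hb' : _ ≤ _ := le_trans (Nat.le_mul_of_pos_left _ hj) hb
      omega

/-- Forgetting the fraction: a `brFrac 1` derivation is a `br` derivation followed by `mono`, so the
fractional calculus at `j = 1` embeds in `SheetCalc · true`. -/
def toSheetCalc {a b t : ℕ} : SheetCalcF Seed 1 a b t → SheetCalc Seed true a b t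
  | seed hs => SheetCalc.seed hs
  | mono d ha hb ht => SheetCalc.mono (toSheetCalc d) ha hb ht
  | swap d => SheetCalc.swap (toSheetCalc d)
  | glue d₁ d₂ hw => SheetCalc.glue (toSheetCalc d₁) (toSheetCalc d₂) hw
  | brFrac d₁ d₂ d₃ hm hb =>
      SheetCalc.mono (SheetCalc.br rfl (toSheetCalc d₁) (toSheetCalc d₂) (toSheetCalc d₃) hm)
        le_rfl (by omega) le_rfl

end SheetCalcF

/-- **From the cube seed the fractional step reaches nothing new either**: no derivation produces the
near-cube brick `(6, 6, 4)` … -/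
theorem cubeSeed_misses_nearCube_frac {j : ℕ} (hj : 1 ≤ j) (h : SheetCalcF cubeSeed j 6 6 4) :
    False := by
  have := h.tame hj fun _ _ _ hs => tame_of_cubeSeed hs
  rw [not_tame_nearCube] at this; exact absurd this (by decide)

/-- … or the `ε`-long square beam `(3, 2, 2)`. -/
theorem cubeSeed_misses_squareBeam_frac {j : ℕ} (hj : 1 ≤ j) (h : SheetCalcF cubeSeed j 3 2 2) :
    False := by
  have := h.tame hj fun _ _ _ hs => tame_of_cubeSeed hs
  rw [not_tame_squareBeam.1] at this; exact absurd this (by decide)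

/-- **Sharpness, uniformly in the fraction.**  For every `j`, from type-`≤ 1` seeds ONE application of
`brFrac j` gives the near-cube brick: anchor the square beam `(2, 6j, 2)` (an `x₁`-sheet of
`[2] × [6j] × [2]`, length `3j`), transversal sheet `(4, 6j, 4)`, `Ξ = (2, 6j, 2)`, `m = 4`,
`t₀ = h = 2`; the output keeps the passive width `6 = 6j / j`: `(2·4 - 2, 6, 2·2) = (6, 6, 4)`. -/
def nearCube_of_looseSeed_frac (j : ℕ) : SheetCalcF looseShape j 6 6 4 :=
  have ha : looseShape 2 (6 * j) 2 = true := by rw [looseShape_iff]; omega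
  have hm : looseShape 4 (6 * j) (2 * 2) = true := by rw [looseShape_iff]; omega
  (SheetCalcF.brFrac (t₀ := 2) (h := 2) (b := 6 * j) (m := 4) (b' := 6) (SheetCalcF.seed ha)
    (SheetCalcF.seed hm) (SheetCalcF.seed ha) (by decide) (by omega) :
    SheetCalcF looseShape j (2 * 4 - 2) 6 (2 * 2))

/-- The near-cube brick is not loose, so `brFrac j` is genuinely type-raising for every `j`
(compare `SheetCalc.loose`: without a reflection rule loose seeds stay loose). -/
theorem nearCube_of_looseSeed_frac_raises (j : ℕ) :
    Nonempty (SheetCalcF looseShape j 6 6 4) ∧ looseShape 6 6 4 = false :=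
  ⟨⟨nearCube_of_looseSeed_frac j⟩, not_loose_nearCube⟩

/-- **Long anchors are free.**  Gluing alone derives the square beam of length `2ⁿ + 2` from the
`ε`-long beam `(3, 2, 2)` and the cube `(2, 2, 2)`: `(ℓ, 2, 2)` and a cube curtain (`w = 2`) give
`(2ℓ - 2, 2, 2)`, so `3 ↦ 4 ↦ 6 ↦ 10 ↦ …`. -/
def squareBeam_of_seedBeam_pow (Seed : ℕ → ℕ → ℕ → Bool) (j : ℕ) (h3 : Seed 3 2 2 = true)
    (h2 : Seed 2 2 2 = true) : (n : ℕ) → SheetCalcF Seed j (2 ^ n + 2) 2 2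
  | 0 => SheetCalcF.seed h3
  | n + 1 =>
      have e : 2 * (2 ^ n + 2) - 2 = 2 ^ (n + 1) + 2 := by rw [Nat.pow_succ]; omega
      e ▸ SheetCalcF.glue (squareBeam_of_seedBeam_pow Seed j h3 h2 n) (SheetCalcF.seed h2)
        (by have := Nat.one_le_two_pow (n := n); omega)

/-- Hence square beams `(k, 2, 2)` of EVERY length `k` (by `mono` from length `2ᵏ + 2 ≥ k`). -/
def squareBeam_of_seedBeam_all (Seed : ℕ → ℕ → ℕ → Bool) (j : ℕ) (h3 : Seed 3 2 2 = true)
    (h2 : Seed 2 2 2 = true) (k : ℕ) : SheetCalcF Seed j k 2 2 :=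
  SheetCalcF.mono (squareBeam_of_seedBeam_pow Seed j h3 h2 k)
    (by have := Nat.lt_two_pow_self (n := k); omega) le_rfl le_rfl

/-- In particular the anchor `(2, 6j, 2)` of `nearCube_of_looseSeed_frac` is a glued square beam
(after the lateral isometry). -/
def anchor_of_seedBeam (Seed : ℕ → ℕ → ℕ → Bool) (j : ℕ) (h3 : Seed 3 2 2 = true)
    (h2 : Seed 2 2 2 = true) : SheetCalcF Seed j 2 (6 * j) 2 :=
  SheetCalcF.swap (squareBeam_of_seedBeam_all Seed j h3 h2 (6 * j))

end Summit.CriticalPhenomena.PercolationContinuityZ3.Theorems
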